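/-
Copyright (c) 2026 the pub-hodgecm-mathlib formalisation cell (harness21).  Prover seat hodgecm-mathlib-A-p19 (g21), D-T road (Tamagawa ∕ (K7-s)),
brick B2e-1 «right and inversion invariance of the centraliser measure at EVERY framed point» (2026-09-01).
-/
import Literature.NumberTheory.Weil1964.UnitaryArchSingularCentralizerTopFormHaarCoherence
import Literature.NumberTheory.Automorphic.UnitaryGroupArchUnimodular
import Literature.NumberTheory.Automorphic.UnitaryGroupArchTopology
import Literature.NumberTheory.Automorphic.ArchLocalRelabelTransport
import Literature.NumberTheory.Automorphic.GLnAdelicIntegrationFactsProofs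
import HarnessLib

/-!
# `centralizerTopFormHaar γ` is right invariant and inversion invariant at every framed `γ` (Rogawski 1990 §1.7 p. 6, §3.8 Prop. 3.8.1 (a); Knapp Cor. 8.31)

Topic `NumberTheory/Weil1964`; namespace `Literature.NumberTheory.Weil1964.UnitaryArchTopForm`.  THEOREMS ONLY (no definition, no instance, no notation, no named fact,
no `sorry`) over ★ B2a–B2d, ★ `UnitaryGroupArchUnimodular` (`modularCharacterFun_arch_eq_one`: `U(J)(L⁺ ⊗ ℝ)` is unimodular), ★ `isMulRightInvariant_of_modularCharacterFun_eq_one`,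
★ `isMulRightInvariant_map_continuousMulEquiv`, ★ `isInvInvariant_of_isMulRightInvariant_of_isClosed` and Mathlib `Measure.prod.instIsMulRightInvariant`.
Cell `pub/hodgecm-mathlib`, crux H413 = `stmt-HodgeConjecture-24833`; D-T road row «D-T3′», brick B2e (the top-form singular family as an `IsQuotientOf` witness):
★ `OrbitalMeasureFamily.IsQuotientOf` asks, at every guarded class, that the centraliser datum be HAAR and INVERSION INVARIANT; B2b gave Haar, B2d gave inversion
invariance at the RATIONAL points `γ₀ ⊗ 1` only (via the adelic retraction); here both invariances at EVERY framed `γ` — the blocks `U(H_a)(L⁺ ⊗ ℝ)`, `U(H_b)(L⁺ ⊗ ℝ)` are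
unimodular real groups, their top-form Haar measures are right invariant, so is the product, and right invariance rides the frame isomorphism `U(H_a) × U(H_b) ≃ₜ* Z(γ)`.

* `isMulRightInvariant_archTopFormHaar_of_isCM` — `archTopFormHaar J` is right invariant (CM situation, `J` hermitian with unit determinant).
* **`isMulRightInvariant_centralizerTopFormHaar`**, **`isInvInvariant_centralizerTopFormHaar`** — for every singular archimedean frame of `γ`.
HONEST SCOPE.  Transport bookkeeping; HC_CM is proved only modulo the printed citations until rung 0 closes; this file discharges no printed statement.

## References
* J. D. Rogawski, *Automorphic Representations of Unitary Groups in Three Variables*, Ann. of Math. Stud. 123 (1990), §1.7 p. 6, §3.8 Prop. 3.8.1 (a) p. 27. [Rogawski1990]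
* A. W. Knapp, *Lie Groups Beyond an Introduction*, 2nd ed. (2002), VIII §2 Cor. 8.31. [Knapp2002]
-/

set_option autoImplicit false

noncomputable section

open NumberField NumberField.mixedEmbedding NumberField.InfinitePlace Set Filter Topology MeasureTheory MeasureTheory.Measure
open Literature.NumberTheory.Automorphic Literature.NumberTheory.Automorphic.UnitaryGroup Literature.NumberTheory.Rogawski1990
open Literature.MeasureTheory.Group
open scoped Classical Matrix MatrixGroups ENNReal NNReal

namespace Literature.NumberTheory.Weil1964

namespace UnitaryArchTopForm

section Invariance

variable (L : Type) [Field L] [NumberField L] [IsCMField L]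

/-- **`archTopFormHaar J` IS RIGHT INVARIANT** in the CM situation, for `J` hermitian with unit determinant: `U(J)(L⁺ ⊗ ℝ)` is unimodular (★ `modularCharacterFun_arch_eq_one`)
and `archTopFormHaar J` is a Haar measure (★ `isHaarMeasure_archTopFormHaar_of_isCM`). [cite: Knapp2002, VIII §2 Cor. 8.31] [cite: Rogawski1990, §1.7 p. 6] -/
theorem isMulRightInvariant_archTopFormHaar_of_isCM {N : ℕ} (J : Matrix (Fin N) (Fin N) L) (hherm : (J.map (IsCMField.complexConj L))ᵀ = J) (hJ : IsUnit J.det)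
    [MeasurableSpace (arch (↥(maximalRealSubfield L)) L (IsCMField.complexConj L) N J)] [BorelSpace (arch (↥(maximalRealSubfield L)) L (IsCMField.complexConj L) N J)]
    [MeasurableSpace (archSkew (↥(maximalRealSubfield L)) L (IsCMField.complexConj L) N J)] [BorelSpace (archSkew (↥(maximalRealSubfield L)) L (IsCMField.complexConj L) N J)] :
    (archTopFormHaar (↥(maximalRealSubfield L)) L (IsCMField.complexConj L) N J).IsMulRightInvariant := by
  haveI := isHaarMeasure_archTopFormHaar_of_isCM J (IsCMField.complexConj_ne_one L) (complexConj_smul_infinitePlace L) hherm hJ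
  exact isMulRightInvariant_of_modularCharacterFun_eq_one
    (fun g => modularCharacterFun_arch_eq_one L J ((map_cmConjRingHom_eq_map_complexConj L J).symm ▸ hherm) hJ.ne_zero g) _

variable {L} {H : Matrix (Fin 3) (Fin 3) L}
  [MeasurableSpace (arch (↥(maximalRealSubfield L)) L (IsCMField.complexConj L) 3 H)] [BorelSpace (arch (↥(maximalRealSubfield L)) L (IsCMField.complexConj L) 3 H)]

/-- **`centralizerTopFormHaar γ` IS RIGHT INVARIANT at every framed `γ`**: the product of the right-invariant block measures `archTopFormHaar H_a ⊗ archTopFormHaar H_b`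
(Mathlib `Measure.prod.instIsMulRightInvariant`) pushed along the frame isomorphism `U(H_a) × U(H_b) ≃ₜ* Z(γ)` (★ `exists_continuousMulEquiv_centralizer_of_frame`, ★
`isMulRightInvariant_map_continuousMulEquiv`). [cite: Rogawski1990, §1.7 p. 6; §3.8 Prop. 3.8.1 (a) p. 27] [cite: Knapp2002, VIII §2 Cor. 8.31] -/
theorem isMulRightInvariant_centralizerTopFormHaar {γ : arch (↥(maximalRealSubfield L)) L (IsCMField.complexConj L) 3 H} {a b : L} {T : GL (Fin 3) (mixedSpace L)}
    {H_a : Matrix (Fin 2) (Fin 2) L} {H_b : Matrix (Fin 1) (Fin 1) L} (h : IsSingularArchFrame L H γ a b T H_a H_b) :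
    (centralizerTopFormHaar L H γ).IsMulRightInvariant := by
  letI : MeasurableSpace (arch (↥(maximalRealSubfield L)) L (IsCMField.complexConj L) 2 H_a) := borel _
  haveI : BorelSpace (arch (↥(maximalRealSubfield L)) L (IsCMField.complexConj L) 2 H_a) := ⟨rfl⟩
  letI : MeasurableSpace (archSkew (↥(maximalRealSubfield L)) L (IsCMField.complexConj L) 2 H_a) := borel _
  haveI : BorelSpace (archSkew (↥(maximalRealSubfield L)) L (IsCMField.complexConj L) 2 H_a) := ⟨rfl⟩
  letI : MeasurableSpace (arch (↥(maximalRealSubfield L)) L (IsCMField.complexConj L) 1 H_b) := borel _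
  haveI : BorelSpace (arch (↥(maximalRealSubfield L)) L (IsCMField.complexConj L) 1 H_b) := ⟨rfl⟩
  letI : MeasurableSpace (archSkew (↥(maximalRealSubfield L)) L (IsCMField.complexConj L) 1 H_b) := borel _
  haveI : BorelSpace (archSkew (↥(maximalRealSubfield L)) L (IsCMField.complexConj L) 1 H_b) := ⟨rfl⟩
  haveI : BorelSpace (arch (↥(maximalRealSubfield L)) L (IsCMField.complexConj L) 2 H_a × arch (↥(maximalRealSubfield L)) L (IsCMField.complexConj L) 1 H_b) :=
    Prod.borelSpace
  haveI := isHaarMeasure_archTopFormHaar_of_isCM H_a (IsCMField.complexConj_ne_one L) (complexConj_smul_infinitePlace L) h.2.1 h.2.2.2.1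
  haveI := isHaarMeasure_archTopFormHaar_of_isCM H_b (IsCMField.complexConj_ne_one L) (complexConj_smul_infinitePlace L) h.2.2.1 h.2.2.2.2.1
  haveI := isMulRightInvariant_archTopFormHaar_of_isCM L H_a h.2.1 h.2.2.2.1
  haveI := isMulRightInvariant_archTopFormHaar_of_isCM L H_b h.2.2.1 h.2.2.2.2.1
  haveI : SigmaFinite (archTopFormHaar (↥(maximalRealSubfield L)) L (IsCMField.complexConj L) 2 H_a) := inferInstance
  haveI : SigmaFinite (archTopFormHaar (↥(maximalRealSubfield L)) L (IsCMField.complexConj L) 1 H_b) := inferInstance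
  haveI : ((archTopFormHaar (↥(maximalRealSubfield L)) L (IsCMField.complexConj L) 2 H_a).prod
      (archTopFormHaar (↥(maximalRealSubfield L)) L (IsCMField.complexConj L) 1 H_b)).IsMulRightInvariant := Measure.prod.instIsMulRightInvariant
  rw [centralizerTopFormHaar_eq_centralizerMeasureOfFrame h, centralizerMeasureOfFrame_def]
  obtain ⟨e, he⟩ := exists_continuousMulEquiv_centralizer_of_frame (N₁ := 2) (N₂ := 1) T h.formCongr_eq h.isUnit_sub γ h.mul_eq
  have hfun : (fun u : arch (↥(maximalRealSubfield L)) L (IsCMField.complexConj L) 2 H_a × arch (↥(maximalRealSubfield L)) L (IsCMField.complexConj L) 1 H_b =>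
      (⟨archFrameEmbedding (N₁ := 2) (N₂ := 1) T h.formCongr_eq u, archFrameEmbedding_mem_centralizer (N₁ := 2) (N₂ := 1) T h.formCongr_eq γ h.mul_eq u⟩ :
        Subgroup.centralizer ({γ} : Set (arch (↥(maximalRealSubfield L)) L (IsCMField.complexConj L) 3 H)))) = ⇑e :=
    funext fun u => Subtype.ext (he u).symm
  rw [hfun]
  exact isMulRightInvariant_map_continuousMulEquiv e _

/-- **`centralizerTopFormHaar γ` IS INVERSION INVARIANT at every framed `γ`** (Haar ★ `isHaarMeasure_centralizerTopFormHaar` + right invariant, on the closed subgroup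
`Z(γ)`: ★ `isInvInvariant_of_isMulRightInvariant_of_isClosed`) — the `IsInvInvariant` conjunct of ★ `OrbitalMeasureFamily.IsQuotientOf` for the top-form datum.
[cite: Rogawski1990, §1.7 p. 6; §3.8 Prop. 3.8.1 (a) p. 27] -/
theorem isInvInvariant_centralizerTopFormHaar {γ : arch (↥(maximalRealSubfield L)) L (IsCMField.complexConj L) 3 H} {a b : L} {T : GL (Fin 3) (mixedSpace L)}
    {H_a : Matrix (Fin 2) (Fin 2) L} {H_b : Matrix (Fin 1) (Fin 1) L} (h : IsSingularArchFrame L H γ a b T H_a H_b) :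
    (centralizerTopFormHaar L H γ).IsInvInvariant := by
  haveI := isHaarMeasure_centralizerTopFormHaar h
  haveI := isMulRightInvariant_centralizerTopFormHaar h
  exact isInvInvariant_of_isMulRightInvariant_of_isClosed _ (Set.isClosed_centralizer _) _

end Invariance

end UnitaryArchTopForm

end Literature.NumberTheory.Weil1964

end
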